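import Literature.AlgebraicGeometry.Motives.Correspondences
import Literature.AlgebraicGeometry.Motives.VarietiesQuasiCompactProofs
import HarnessLib

/-!
# Discharged fact: `D(X)` ⇔ "numerically trivial cycles are homologically trivial"

`Literature.AlgebraicGeometry.Motives.Correspondences` records as a named fact
(`Literature.AlgebraicGeometry.Motives.WeilCohomology.standardConjectureD_iff_isNumericallyTrivial : Prop`)
the reformulation of Grothendieck's standard conjecture `D(X)` — stated there in Kleiman's
abstract form "the cup-product pairing `Aᵖ(X)_ℚ × Aⁿ⁻ᵖ(X)_ℚ → K` has trivial left kernel"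
(`W.StandardConjectureD n X`) — as the statement about cycles "every numerically trivial
codimension-`p` cycle (`p ≤ n`) is homologically trivial" (Kleiman, *Algebraic cycles and the
Weil conjectures* (1968), §3: the equivalence relations `∼_hom`, `∼_num` of 3.1 and conjecture
`D(X)`; Murre, *Algebraic cycles and algebraic aspects of cohomology and K-theory* (Torino 1993),
§§1.4.3–1.4.6: `Z ∼_num 0`, `Z ∼_hom 0`, "Conjecture 1.4.6: `Zⁱ_hom(X) = Zⁱ_num(X)`", and §7.7:
`Aⁱ(X) = Im(γⁱ) ⊗ ℚ` with the cup-product pairing in complementary degrees). This file proves it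
(`standardConjectureD_iff_isNumericallyTrivial_holds`), so users holding
`(h : standardConjectureD_iff_isNumericallyTrivial)` (e.g.
`Literature.AlgebraicGeometry.Motives.StandardConjectures`, hypothesis `hD` of
`homNumStandardConjecture_iff_isNumericallyTrivial`) can discharge it.

## Proof

As announced in the fact's docstring, nothing beyond the definitions, the additivity of the
cycle map on the quasi-compact space `X` (`IsSmoothProjective.compactSpace_holds`, Hartshorne
II.4.9) and `CharZero K` is used:

* `Aᵖ(X)` (`W.algebraicLattice X p`, the subgroup generated by the classes of prime cycles of
  codimension `p`) is exactly the set of classes `γ(c)` of codimension-`p` cycles `c ∈ Zᵖ(X)`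
  (`PreWeilCohomology.exists_cycleMap_eq_of_mem_algebraicLattice`, by induction on the closure,
  using `γ([closure {z}]) = cycleClass z` and additivity; that one-term computation is the tree's
  `PreWeilCohomology.cycleMap_primeCycle` (`Literature.AlgebraicGeometry.Motives.WeilCohomologyProofs`),
  repeated here as a `private` lemma only to keep this file's import closure free of the dimension
  theory that module pulls in);
* `Aᵖ(X)_ℚ` (`W.ratAlgebraicClasses X p`) is the divisible hull `{x | ∃ N ≠ 0, N • x ∈ Aᵖ(X)}`, and
  the pairing `(x, y) ↦ tr (x ∪ y)` is biadditive with values in the characteristic-zero field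
  `K`, so "`x` pairs to zero with `A^q(X)`" and "`x` pairs to zero with `A^q(X)_ℚ`" agree
  (`PreWeilCohomology.cupPairing_eq_zero_of_mem_ratAlgebraicClasses`), and `N • x = 0`, `N ≠ 0`
  forces `x = 0` in the `K`-vector space `H²ᵖ(X)`.

`(⇒)` For `c ∈ Zᵖ(X)` numerically trivial, `x = γ(c) ∈ Aᵖ(X) ⊆ Aᵖ(X)_ℚ` pairs to zero with every
`γ(c')`, `c' ∈ Z^q(X)`, hence with `A^q(X)` and with `A^q(X)_ℚ`; `D(X)` gives `γ(c) = 0`.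
`(⇐)` For `x ∈ Aᵖ(X)_ℚ` in the left kernel, pick `N ≠ 0` with `N • x = γ(c)`, `c ∈ Zᵖ(X)`; then
`c` is numerically trivial (`tr (γ(c) ∪ γ(c')) = N • tr (x ∪ γ(c')) = 0` as `γ(c') ∈ A^q(X)_ℚ`),
so `γ(c) = N • x = 0` by hypothesis, whence `x = 0`.

## References

* S. L. Kleiman, *Algebraic cycles and the Weil conjectures*, in: Dix exposés sur la cohomologie
  des schémas, North-Holland (1968), 359–386, §3. [Kleiman1968] = [Kleiman1968AlgebraicCycles]
  (not held; requested, see the session notes).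
* J. P. Murre, *Algebraic cycles and algebraic aspects of cohomology and K-theory*, in: Algebraic
  Cycles and Hodge Theory (Torino 1993), LNM 1594 (1994), 93–152, §§1.4.3–1.4.6 and §7.7
  (held: book:green1994-algebraic-cycles-hodge-theory-lectures-given-at, PDF pp. 81–82, 123).
  [MurreTorino1994]
* J. P. Murre, *Lectures on algebraic cycles and Chow groups*, Ch. 9 of Hodge Theory (MN-49,
  2014), §9.2.3 Def. 9.2.6, §9.2.4 Def. 9.2.8, Remark 9.2.9(b) and conjecture `D(X)`.
  [CattaniElZeinGriffithsLe2014]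
-/

universe u v

open CategoryTheory AlgebraicGeometry

noncomputable section

namespace Literature.AlgebraicGeometry.Motives

namespace PreWeilCohomology

variable {k : Type u} [Field k] {K : Type v} [Field K] (W : PreWeilCohomology k K)
variable (X : SchemeOver k) (p : ℕ)

/-- `γ([closure {z}]) = cycleClass z`: the defining sum `∑ᶠ z', [closure {z}](z') • cycleClass z'` has
the single term `z' = z`. A `private` copy of `PreWeilCohomology.cycleMap_primeCycle`
(module `Literature.AlgebraicGeometry.Motives.WeilCohomologyProofs`, whose dimension-theory imports
are not wanted here). [folklore] -/
private theorem cycleMap_primeCycle_local (z : X.left) :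
    W.cycleMap X p (primeCycle z) = W.cycleClass X p z := by
  unfold cycleMap
  rw [finsum_eq_single _ z fun z' hz' ↦ by rw [primeCycle_apply_of_ne hz', zero_smul],
    primeCycle_apply_self, one_smul]

/-- On a quasi-compact scheme the cycle map is compatible with negation, `γ(-c) = -γ(c)`
(it is additive, `cycleMap_add`). [folklore] -/
theorem cycleMap_neg [CompactSpace X.left] (c : AlgebraicCycle X.left ℤ) :
    W.cycleMap X p (-c) = -W.cycleMap X p c := by
  rw [eq_neg_iff_add_eq_zero, ← W.cycleMap_add X p, neg_add_cancel, W.cycleMap_zero X p]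

/-- On a quasi-compact `X`, every element of the algebraic lattice `Aᵖ(X) ⊆ H²ᵖ(X)` is the class
of a codimension-`p` cycle: `Aᵖ(X) = γ(Zᵖ(X))` (Kleiman 1968 §1.4 and §3.1, where
`Aᵖ(X) = Zᵖ(X)/∼_hom` by definition; Murre 1994 §7.7, `Aⁱ(X) = Im(γⁱ)`). Induction on the
closure: generators are classes of prime cycles (`PreWeilCohomology.cycleMap_primeCycle`), and `γ` is
additive. [folklore] -/
theorem exists_cycleMap_eq_of_mem_algebraicLattice [CompactSpace X.left] {x : W.obj X (2 * p)}
    (hx : x ∈ W.algebraicLattice X p) :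
    ∃ c ∈ cyclesOfCodim X.left p, W.cycleMap X p c = x := by
  induction hx using AddSubgroup.closure_induction with
  | mem x hx =>
    obtain ⟨z, rfl⟩ := hx
    exact ⟨primeCycle z.1, primeCycle_mem_cyclesOfCodim z.2, W.cycleMap_primeCycle_local X p z.1⟩
  | zero => exact ⟨0, zero_mem _, W.cycleMap_zero X p⟩
  | add x y _ _ hx hy =>
    obtain ⟨c, hc, rfl⟩ := hx
    obtain ⟨c', hc', rfl⟩ := hy
    exact ⟨c + c', add_mem hc hc', W.cycleMap_add X p c c'⟩
  | neg x _ hx =>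
    obtain ⟨c, hc, rfl⟩ := hx
    exact ⟨-c, neg_mem hc, W.cycleMap_neg X p c⟩

/-- A class `x ∈ Hⁱ(X)` that pairs to zero (for `(x, y) ↦ tr_X (x ∪ y)`) with the lattice
`A^q(X)` pairs to zero with its divisible hull `A^q(X)_ℚ = {y | ∃ N ≠ 0, N • y ∈ A^q(X)}`:
the pairing is additive in `y` and `N • t = 0`, `N ≠ 0` forces `t = 0` in the characteristic-zero
field `K`. [folklore] -/
theorem cupPairing_eq_zero_of_mem_ratAlgebraicClasses [CharZero K] (n i q : ℕ)
    (h : i + 2 * q = 2 * n) (x : W.obj X i)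
    (hx : ∀ z ∈ W.algebraicLattice X q, W.cupPairing X n i (2 * q) h x z = 0)
    {y : W.obj X (2 * q)} (hy : y ∈ W.ratAlgebraicClasses X q) :
    W.cupPairing X n i (2 * q) h x y = 0 := by
  obtain ⟨N, hN, hNy⟩ := hy
  have h1 : W.cupPairing X n i (2 * q) h x (N • y) = 0 := hx _ hNy
  rw [map_zsmul, zsmul_eq_mul] at h1
  exact (mul_eq_zero.mp h1).resolve_left (Int.cast_ne_zero.mpr hN)

end PreWeilCohomology

namespace WeilCohomology

variable {k : Type u} [Field k] {K : Type v} [Field K] [CharZero K] {W : WeilCohomology k K}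
variable {n : ℕ} {X : SchemeOver k}

/-- Discharge of the named fact
`Literature.AlgebraicGeometry.Motives.WeilCohomology.standardConjectureD_iff_isNumericallyTrivial`
(**`D(X)` ⇔ numerical equivalence implies homological equivalence**): for `X` smooth projective
of dimension `n`, Kleiman's form of the standard conjecture `D(X)` — the cup-product pairing
`Aᵖ(X)_ℚ × A^q(X)_ℚ → K`, `p + q = n`, has trivial left kernel (`W.StandardConjectureD n X`) —
holds iff every numerically trivial codimension-`p` cycle, `p ≤ n`, is homologically trivial
(Kleiman 1968 §3: the relations `Z ∼_num 0`, `Z ∼_hom 0` of 3.1 and conjecture `D(X)`;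
Murre 1994 §§1.4.3–1.4.6, Conjecture 1.4.6 "`Zⁱ_hom(X) = Zⁱ_num(X)`", and §7.7,
`Aⁱ(X) = Im(γⁱ) ⊗ ℚ`). The proof is the bookkeeping announced in the fact's docstring:
`Aᵖ(X) = γ(Zᵖ(X))` (`PreWeilCohomology.exists_cycleMap_eq_of_mem_algebraicLattice`, which uses the
additivity of `γ` on the compact space `X`, `IsSmoothProjective.compactSpace_holds`), `Aᵖ(X)_ℚ` is
the divisible hull of `Aᵖ(X)`, the pairing is biadditive, and `K` has characteristic zero
(`PreWeilCohomology.cupPairing_eq_zero_of_mem_ratAlgebraicClasses`).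
[cite: Kleiman1968, §3 (3.1: Z ∼_num 0, Z ∼_hom 0; conjecture D(X))]
[cite: MurreTorino1994, §1.4.3–1.4.6 (Conjecture 1.4.6) and §7.7 (A^i(X) = Im(γ^i) ⊗ Q), PDF pp. 81–82, 123] -/
theorem standardConjectureD_iff_isNumericallyTrivial_holds :
    standardConjectureD_iff_isNumericallyTrivial (W := W) (n := n) (X := X) := by
  intro hX
  haveI : CompactSpace X.left := IsSmoothProjective.compactSpace_holds hX
  constructor
  · -- `D(X)` ⇒ numerically trivial cycles are homologically trivial
    intro hD p hp c hc hnum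
    obtain ⟨q, hq⟩ : ∃ q, p + q = n := ⟨n - p, by omega⟩
    refine hD p q hq _ (W.algebraicLattice_le_ratAlgebraicClasses X p
      (W.cycleMap_mem_algebraicLattice X p hc)) fun y hy ↦ ?_
    refine W.cupPairing_eq_zero_of_mem_ratAlgebraicClasses X n (2 * p) q (by omega) _
      (fun z hz ↦ ?_) hy
    obtain ⟨c', hc', rfl⟩ := W.exists_cycleMap_eq_of_mem_algebraicLattice X q hz
    exact hnum q hq c' hc'
  · -- numerically trivial ⇒ homologically trivial gives `D(X)`
    intro h p q hq x hx hperp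
    obtain ⟨N, hN, hNx⟩ := hx
    obtain ⟨c, hc, hcx⟩ := W.exists_cycleMap_eq_of_mem_algebraicLattice X p hNx
    have hNK : (N : K) ≠ 0 := Int.cast_ne_zero.mpr hN
    have hnum : W.IsNumericallyTrivial n X p c := by
      intro q' hq' c' hc'
      obtain rfl : q = q' := by omega
      rw [hcx, ← Int.cast_smul_eq_zsmul K, LinearMap.map_smul₂,
        hperp _ (W.algebraicLattice_le_ratAlgebraicClasses X q
          (W.cycleMap_mem_algebraicLattice X q hc')), smul_zero]
    have hNx0 : (N : K) • x = 0 := by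
      rw [Int.cast_smul_eq_zsmul, ← hcx]
      exact h p (by omega) c hc hnum
    calc x = (N : K)⁻¹ • ((N : K) • x) := by rw [smul_smul, inv_mul_cancel₀ hNK, one_smul]
      _ = 0 := by rw [hNx0, smul_zero]

end WeilCohomology

end Literature.AlgebraicGeometry.Motives

end
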